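import Mathlib
import Literature.MathematicalPhysics.QuantumFieldTheory.Balaban1983to89.B14InterpolationMeasure

/-!
# `Balaban1983to89.B14.Eq330Printed` — T. Bałaban, *Convergent renormalization expansions for lattice gauge theories*,
# Commun. Math. Phys. **119** (1988) 243–285 [Balaban1988Convergent] = [III]: (3.30) p. 272 IN ITS PRINTED THREE-TERM
# CHAIN-RULE FORM, for genuine integrals — the `t = 0` split of the normalization factor into the Gaussian normalization
# and `log ∫dμ χ^{(k)}`, and the factor `g_k` with the `∂/∂(tg_k)`-derivatives, on top of p27's `B14.InterpolationMeasure`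

statement-level skeleton of published theorems with citation tags; proofs where landed; nothing here is a claim
about the Yang–Mills mass gap

CITATION HEADER (lean-in-tree rule 2026-08-18).  T. Bałaban, *Convergent renormalization expansions for lattice gauge
theories*, Commun. Math. Phys. **119**, 243–285 (1988), doi:10.1007/BF01217741, bib `Balaban1988Convergent` (cell paper
B14; PDF held `paper:balaban1988-cmp119-convergent-renormalization`, journal page = PDF page + 242; the display (3.30) was
RE-READ for this file on the x2 render `…-p030-x2.png` of `run/shared/lean/pub/pub-balaban/b2b-balaban-ref1/pages/`).
Mega-formalization `lit-balaban`, HOME `run/shared/lean/pub/lit-balaban/`, unit `lit-balaban-r11` gen 9 (B14 fold owner;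
SKELETON row **B14.Eq3.30**, typed shape of record `B14.Interpolation.Eq330` p238819, measure-theoretic form
`B14.InterpolationMeasure.GibbsFamily.eq330_gibbs` p243938 by seat p27).

THE PRINT (p. 272 [PDF 30], verbatim from the render).  *"The remaining expression in (3.28), the last logarithm, is
formally given by the same formula as the term E^{(k+1)} in [I] [see (2.12), (2.13)], but the integral is restricted to
Λ_{k+1}, and operators are determined by the sequence {Ω_j}. To get the representation (2.26), (2.27) we expand this
expression with respect to g_k up to the first order. … Multiplying g_k by the parameter t we have
  [the logarithm on the right-hand side of (3.28)]
    = log[z^{(k)} ∫ dA exp[−½⟨A, C*Δ^{(k)}CA⟩]] + log ∫ dμ_{C^{(k)}(Λ_{k+1})} χ^{(k)}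
      + g_k ∫₀¹ dt ⟨ (∂/∂tg_k) 𝐏^{(k)}(tg_k, A) + (∂/∂tg_k) E_k(U_k(…tg_kCA…)) ⟩_t,   (3.30)
where the expectation value is with respect to the probabilistic measure defined by the function χ^{(k)} exp[…tg_k…] in
the logarithm, but with the constant g_k replaced by tg_k."*  The logarithm on the right-hand side of (3.28) is
*"log[z^{(k)} ∫ dAχ^{(k)} exp[−½⟨A, C*Δ^{(k)}CA⟩ + 𝐏^{(k)}(g_k, A) + {E_k(U_k(exp i[g_kCA − hD̃(g_kCA)]V^{(k)})) −
E_k(U_{k+1})}]]"* (p. 272, same render).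

READING (the objects of §2 of the paper are not constructed in the tree; this is the calculus the display rests on, as in
`B14.InterpolationMeasure`).  `ν` := the normalized Gaussian measure `dμ_{C^{(k)}(Λ_{k+1})}` on the fluctuation variables
`A` (any measure space here); the reference weight `w := N·χ` with `χ = χ^{(k)}` and `N := z^{(k)} ∫ dA exp[−½⟨A, C*Δ^{(k)}CA⟩]
> 0` the Gaussian normalization — so that `z^{(k)} ∫ dA χ^{(k)} e^{−½⟨…⟩ + S} = N ∫ χ e^{S} dμ = Z` is the argument of
the logarithm of (3.28) and `log N` is the FIRST printed term; the parametrised exponent `S_t(A) := 𝐏^{(k)}(tg_k, A) +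
{E_k(U_k(…tg_kCA…)) − E_k(U_{k+1})}` (*"the constant g_k replaced by tg_k"*), which VANISHES AT `t = 0` — the hypothesis
`hS0`: this is what print's second term `log ∫ dμ χ^{(k)}` (no exponential left) says; it is a reading of the display, not
a separately printed statement (every term of `𝐏^{(k)}` carries a positive power of `g_k`, and at `g_k → 0` the argument
of `E_k` is `U_k(V^{(k)})`; neither fact is typed here) —; and the chain rule `S_t = R(tg_k)`, `∂_tS_t = g_k·(∂_τR)(tg_k)`,
which produces print's factor `g_k` and the `∂/∂(tg_k)`-derivatives of the third term.

WHAT THIS FILE PROVES (kernel-checked, zero `sorry`; theorems only — no `def`, no new `Prop`, no named fact; axioms standard),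
for a `GibbsFamily ν w S S' a b` of `B14.InterpolationMeasure` (integrable `w ≥ 0` a.e. of positive integral; `S`, `S'`
measurable, a.e. bounded, `∂_tS_t = S'_t` on `(a,b) ⊃ [0,1]`):
* `partFn_eq_integral_of_ae_eq_zero` — if `S_0 = 0` a.e. then `Z_0 = ∫ w dν`;
* `log_partFn_zero_split` — with `w = N·χ`, `N > 0`: `log Z_0 = log N + log ∫ χ dν` (the first two printed terms);
* **`eq330_printed`** — `log Z_1 = log N + log ∫ χ dν + ∫₀¹ dt ⟨∂_tS_t⟩_t` ((3.30) with the `t = 0` split, from p27's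
  `GibbsFamily.eq330_gibbs` = the typed `B14.Interpolation.Eq330`);
* `gibbsExpect_const_mul` — `⟨g·G⟩_t = g·⟨G⟩_t`;
* **`eq330_printed_chainRule`** — for `S_t = R(tg)` with `τ`-derivative `R′`: `log Z_1 = log N + log ∫ χ dν +
  g·∫₀¹ dt ⟨R′(tg)⟩_t` — the display (3.30) VERBATIM in structure (*"g_k ∫₀¹ dt ⟨(∂/∂tg_k)(…)⟩_t"*).
HONEST SCOPE.  Exactly that of `B14.InterpolationMeasure` (p27): a calculus identity for genuine integrals under qualitative
regularity binders (print: bounded analytic functions of the fields on the domain cut out by `χ^{(k)}`); the identification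
of `ν`, `χ`, `N`, `R` with Bałaban's `dμ_{C^{(k)}(Λ_{k+1})}`, `χ^{(k)}`, `z^{(k)}∫dA e^{−½⟨A,C*Δ^{(k)}CA⟩}`,
`𝐏^{(k)}(τ, A) + E_k(U_k(…τCA…)) − E_k(U_{k+1})` is the READING above, and the vanishing of the exponent at `t = 0` is the
hypothesis `hS0`.  NOT summit progress.  r11 gen 9 (literature-prover-lit-balaban-r11-g9-0).
-/

noncomputable section

open _root_.MeasureTheory _root_.Set _root_.Filter
open scoped Topology ENNReal BigOperators

namespace Literature.MathematicalPhysics.QuantumFieldTheory.Balaban1983to89.B14.Eq330Printed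

open B14.InterpolationMeasure B14.InterpolationMeasure.GibbsFamily

variable {Ω : Type*} [MeasurableSpace Ω] {ν : Measure Ω} {w : Ω → ℝ} {S S' : ℝ → Ω → ℝ} {a b : ℝ}

/-! ## §1 The value at `t = 0`: the Gaussian normalization and `log ∫ dμ χ^{(k)}` -/

/-- **`Z_0 = ∫ w dν` when the parametrised exponent vanishes at `t = 0`** (*"with the constant g_k replaced by tg_k"*,
`t = 0`: no exponential is left in print's second term `log ∫ dμ_{C^{(k)}(Λ_{k+1})} χ^{(k)}`).
[cite: Balaban1988Convergent, (3.30) p.272] -/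
theorem partFn_eq_integral_of_ae_eq_zero (hS0 : ∀ᵐ ω ∂ν, S 0 ω = 0) :
    partFn ν w S 0 = ∫ ω, w ω ∂ν := by
  unfold partFn
  refine integral_congr_ae ?_
  filter_upwards [hS0] with ω hω
  rw [gibbsWeight, hω, Real.exp_zero, mul_one]

/-- **The first two terms of (3.30)**: with the reference weight `w = N·χ` (`N = z^{(k)}∫dA exp[−½⟨A, C*Δ^{(k)}CA⟩] > 0`
the Gaussian normalization, `χ = χ^{(k)}`, `∫ χ dν > 0`) and `S_0 = 0` a.e.:
`log Z_0 = log[z^{(k)}∫dA exp[−½⟨A,C*Δ^{(k)}CA⟩]] + log ∫ dμ_{C^{(k)}(Λ_{k+1})} χ^{(k)}`.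
[cite: Balaban1988Convergent, (3.30) p.272] -/
theorem log_partFn_zero_split (hS0 : ∀ᵐ ω ∂ν, S 0 ω = 0) {N : ℝ} (hN : 0 < N) {χ : Ω → ℝ}
    (hw : w = fun ω => N * χ ω) (hχ : 0 < ∫ ω, χ ω ∂ν) :
    Real.log (partFn ν w S 0) = Real.log N + Real.log (∫ ω, χ ω ∂ν) := by
  rw [partFn_eq_integral_of_ae_eq_zero hS0, hw, MeasureTheory.integral_const_mul,
    Real.log_mul hN.ne' hχ.ne']

/-! ## §2 (3.30) with the `t = 0` split -/

/-- **(3.30) p. 272 WITH THE `t = 0` SPLIT, for genuine integrals**: for a Gibbs family ((3.27)/(3.29): reference weight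
`w = N·χ^{(k)}`, exponent `S_t` = *"… with the constant g_k replaced by tg_k"*, `S_0 = 0`),
`log Z_1 = log N + log ∫ χ dν + ∫₀¹ dt ⟨∂_tS_t⟩_t` — p27's `GibbsFamily.eq330_gibbs` (the typed `B14.Interpolation.Eq330`:
`log Z_1 = log Z_0 + ∫₀¹ dt ⟨∂_tS_t⟩_t`) followed by `log_partFn_zero_split`.  The positivity `∫ χ dν > 0` follows from the
family's `∫ w dν > 0`. [cite: Balaban1988Convergent, (3.30) p.272, (3.27) p.271] -/
theorem eq330_printed (h : GibbsFamily ν w S S' a b) (hS0 : ∀ᵐ ω ∂ν, S 0 ω = 0) {N : ℝ} (hN : 0 < N) {χ : Ω → ℝ}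
    (hw : w = fun ω => N * χ ω) :
    Real.log (partFn ν w S 1)
      = Real.log N + Real.log (∫ ω, χ ω ∂ν) + ∫ t in (0:ℝ)..1, gibbsExpect ν w S (S' t) t := by
  have hχ : 0 < ∫ ω, χ ω ∂ν := by
    have hwpos := h.w_pos
    rw [hw, MeasureTheory.integral_const_mul] at hwpos
    exact pos_of_mul_pos_right hwpos hN.le
  have h330 : Real.log (partFn ν w S 1)
      = Real.log (partFn ν w S 0) + ∫ t in (0:ℝ)..1, gibbsExpect ν w S (S' t) t := h.eq330_gibbs
  rw [h330, log_partFn_zero_split hS0 hN hw hχ]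

/-! ## §3 The chain-rule form: the factor `g_k` and the `∂/∂(tg_k)`-derivatives -/

omit [MeasurableSpace Ω] in
/-- Linearity of the tilted expectation in the insert: `⟨g·G⟩_t = g·⟨G⟩_t`. [cite: Balaban1988Convergent, (3.27) p.271] -/
theorem gibbsExpect_const_mul {_ : MeasurableSpace Ω} (ν : Measure Ω) (w : Ω → ℝ) (S : ℝ → Ω → ℝ) (g : ℝ)
    (G : Ω → ℝ) (t : ℝ) :
    gibbsExpect ν w S (fun ω => g * G ω) t = g * gibbsExpect ν w S G t := by
  simp only [gibbsExpect, gibbsNum, mul_assoc, MeasureTheory.integral_const_mul, mul_div_assoc]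

/-- **(3.30) p. 272 VERBATIM IN STRUCTURE — the chain-rule form.**  If the parametrised exponent is `S_t = R(tg)`
(*"Multiplying g_k by the parameter t"*: `R(τ, A) = 𝐏^{(k)}(τ, A) + {E_k(U_k(…τCA…)) − E_k(U_{k+1})}` at `τ = tg_k`) with
`τ`-derivative `R′`, so that `∂_tS_t = g·R′(tg)` (chain rule — the family's derivative datum), then
  `log Z_1 = log N + log ∫ χ dν + g·∫₀¹ dt ⟨R′(tg)⟩_t`,
i.e. *"log[z^{(k)}∫dA exp[−½⟨A,C*Δ^{(k)}CA⟩]] + log ∫dμ_{C^{(k)}(Λ_{k+1})}χ^{(k)} + g_k∫₀¹dt⟨(∂/∂tg_k)𝐏^{(k)}(tg_k,A) +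
(∂/∂tg_k)E_k(U_k(…tg_kCA…))⟩_t"* with `⟨·⟩_t` the expectation in the measure defined by `χ^{(k)}exp[…tg_k…]` ((3.29) at
`g_k ↦ tg_k`, `B14.InterpolationMeasure.gibbsLaw`). [cite: Balaban1988Convergent, (3.30) p.272, (3.29) p.272] -/
theorem eq330_printed_chainRule {R' : ℝ → Ω → ℝ} {g : ℝ}
    (h : GibbsFamily ν w S (fun t ω => g * R' (t * g) ω) a b) (hS0 : ∀ᵐ ω ∂ν, S 0 ω = 0)
    {N : ℝ} (hN : 0 < N) {χ : Ω → ℝ} (hw : w = fun ω => N * χ ω) :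
    Real.log (partFn ν w S 1)
      = Real.log N + Real.log (∫ ω, χ ω ∂ν) + g * ∫ t in (0:ℝ)..1, gibbsExpect ν w S (R' (t * g)) t := by
  rw [eq330_printed h hS0 hN hw, ← intervalIntegral.integral_const_mul]
  congr 1
  refine intervalIntegral.integral_congr fun t _ => ?_
  exact gibbsExpect_const_mul ν w S g (R' (t * g)) t

end Literature.MathematicalPhysics.QuantumFieldTheory.Balaban1983to89.B14.Eq330Printed

end
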